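import Summits.KontsevichZagierPeriods.KontsevichZagierPeriods.Theses.IsogenyCertificates
import Literature.NumberTheory.EllipticCurves.XMapCertificate
import Summits.KontsevichZagierPeriods.KontsevichZagierPeriods.Theorems.IsogenyCertificatesAlgebraicModuliRealPeriodCellPeriodRep

/-!
# `AlgebraicModuliRealPeriodCell` (stmt-KontsevichZagierPeriods-18265, route IsogenyCertificates) —
line `Sketch`, stub T (`stub_algXMapTransfer`), phase 1a (i): the real-algebraic datum

Port of the datum basics of the `ℚ`-line (`Theorems/XMapPeriodTransfer/Negative/LoadBearingDatum.lean`: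
`cubic_ne_zero`, `g_ne_zero_and_c_ne_zero`, `iff_coprime`) to REAL-ALGEBRAIC data. A datum from
`y² = x³ + αx + β` to `y² = x³ + α'x + β'` (`α β α' β' : ℝ` algebraic over `ℚ`) is a triple
`(f, g, c)`, `f g : ℝ[X]` with algebraic coefficients, `c : ℝ` algebraic, with Wronskian
`W = f'g − fg' ≠ 0` and certificate identity `c²·g·(f³ + α'fg² + β'g³) = (X³ + αX + β)·W²`
(always written out inline; no definitions are introduced).

* `cubic_ne_zero`, `g_ne_zero_and_c_ne_zero` — the cubic is monic; a datum has `g ≠ 0`, `c ≠ 0`;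
* `exists_isCoprime_datum` — **WLOG `f, g` coprime**, keeping algebraic coefficients: lift the datum
  to `K[X]`, `K = algebraicClosure ℚ ℝ` the field of real algebraic numbers
  (`PeriodRep.exists_map_eq_of_coeff_isAlgebraic`, `Polynomial.map_injective`), take lowest terms
  there (`HasXMapCertificate.exists_isCoprime`, any field), and map back (`IsCoprime.map`).

References: L. C. Washington, *Elliptic Curves* (2008), §2.9; M. Kontsevich, D. Zagier, *Periods*
(2001), §1.1–1.2.
-/

noncomputable section

namespace Summit.KontsevichZagierPeriods.IsogenyCertificates.AlgRealPeriodCell.TransferDatum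

open Polynomial Set
open Literature.NumberTheory.EllipticCurves (HasXMapCertificate xMapWronskian_def)
open Summit.KontsevichZagierPeriods.IsogenyCertificates.AlgRealPeriodCell.PeriodRep
  (algebraicClosure_isAlgebraic exists_map_eq_of_coeff_isAlgebraic algebraMap_algebraicClosure_apply)

/-! ### Forced non-degeneracy -/

/-- The Weierstrass cubic `X³ + αX + β ∈ ℝ[X]` is never the zero polynomial (it is monic). [folklore] -/
theorem cubic_ne_zero (α β : ℝ) : (X ^ 3 + C α * X + C β : ℝ[X]) ≠ 0 := by
  have hm : (X ^ 3 + (C α * X + C β) : ℝ[X]).Monic :=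
    monic_X_pow_add (degree_linear_le.trans_lt (by norm_num))
  rw [← add_assoc] at hm
  exact hm.ne_zero

/-- **Forced non-degeneracy**: a real datum has `g ≠ 0` and `c ≠ 0` (`g = 0` kills `W`, `c = 0`
gives `P·W² = 0` in the domain `ℝ[X]`). [folklore] -/
theorem g_ne_zero_and_c_ne_zero {α β α' β' : ℝ} {f g : ℝ[X]} {c : ℝ}
    (hW : derivative f * g - f * derivative g ≠ 0)
    (hI : C (c ^ 2) * g * (f ^ 3 + C α' * f * g ^ 2 + C β' * g ^ 3) =
        (X ^ 3 + C α * X + C β) * (derivative f * g - f * derivative g) ^ 2) :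
    g ≠ 0 ∧ c ≠ 0 := by
  refine ⟨?_, ?_⟩
  · rintro rfl; exact hW (by simp)
  · rintro rfl
    simp only [ne_eq, OfNat.ofNat_ne_zero, not_false_eq_true, zero_pow, map_zero, zero_mul] at hI
    exact (mul_ne_zero (cubic_ne_zero α β) (pow_ne_zero 2 hW)) hI.symm

/-! ### Lifting to the field of real algebraic numbers -/

/-- The coefficients of the image in `ℝ[X]` of a polynomial over `algebraicClosure ℚ ℝ` are
algebraic. [folklore] -/
theorem coeff_map_isAlgebraic (F : (↥(algebraicClosure ℚ ℝ))[X]) (n : ℕ) :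
    IsAlgebraic ℚ ((F.map (algebraMap (↥(algebraicClosure ℚ ℝ)) ℝ)).coeff n) := by
  rw [coeff_map]
  exact algebraicClosure_isAlgebraic _

/-- The Wronskian commutes with `Polynomial.map`. [folklore] -/
theorem map_wronskian {R S : Type*} [CommRing R] [CommRing S] (i : R →+* S) (F G : R[X]) :
    (derivative F * G - F * derivative G).map i =
      derivative (F.map i) * G.map i - F.map i * derivative (G.map i) := by
  simp only [Polynomial.map_sub, Polynomial.map_mul, derivative_map]

/-- The certificate identity commutes with `Polynomial.map` (both sides). [folklore] -/
theorem map_identity {R S : Type*} [CommRing R] [CommRing S] (i : R →+* S) (F G : R[X])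
    (a b a' b' u : R) :
    (C (u ^ 2) * G * (F ^ 3 + C a' * F * G ^ 2 + C b' * G ^ 3)).map i =
      C (i u ^ 2) * G.map i * ((F.map i) ^ 3 + C (i a') * F.map i * (G.map i) ^ 2 +
        C (i b') * (G.map i) ^ 3) ∧
    ((X ^ 3 + C a * X + C b) * (derivative F * G - F * derivative G) ^ 2).map i =
      (X ^ 3 + C (i a) * X + C (i b)) *
        (derivative (F.map i) * G.map i - F.map i * derivative (G.map i)) ^ 2 := by
  constructor
  · simp only [Polynomial.map_mul, Polynomial.map_add, Polynomial.map_pow, map_C, map_pow]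
  · simp only [Polynomial.map_mul, Polynomial.map_add, Polynomial.map_pow, map_C, map_X,
      map_wronskian]

/-- **WLOG `f, g` coprime.** A real-algebraic datum `(f, g, c)` from `(α, β)` to `(α', β')` can be
replaced by one in lowest terms, `IsCoprime f g`, still with algebraic coefficients and algebraic
`c`: lift to `K[X]`, `K = ℚ̄ ∩ ℝ`, divide by the gcd there (`HasXMapCertificate.exists_isCoprime`),
map back to `ℝ[X]`. [cite: Washington2008, §2.9] -/
theorem exists_isCoprime_datum {α β α' β' : ℝ} (hα : IsAlgebraic ℚ α) (hβ : IsAlgebraic ℚ β)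
    (hα' : IsAlgebraic ℚ α') (hβ' : IsAlgebraic ℚ β') {f g : ℝ[X]} {c : ℝ}
    (hf : ∀ n, IsAlgebraic ℚ (f.coeff n)) (hg : ∀ n, IsAlgebraic ℚ (g.coeff n))
    (hc : IsAlgebraic ℚ c) (hW : derivative f * g - f * derivative g ≠ 0)
    (hI : C (c ^ 2) * g * (f ^ 3 + C α' * f * g ^ 2 + C β' * g ^ 3) =
        (X ^ 3 + C α * X + C β) * (derivative f * g - f * derivative g) ^ 2) :
    ∃ (f₁ g₁ : ℝ[X]) (c₁ : ℝ), (∀ n, IsAlgebraic ℚ (f₁.coeff n)) ∧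
      (∀ n, IsAlgebraic ℚ (g₁.coeff n)) ∧ IsAlgebraic ℚ c₁ ∧ IsCoprime f₁ g₁ ∧
      derivative f₁ * g₁ - f₁ * derivative g₁ ≠ 0 ∧
      C (c₁ ^ 2) * g₁ * (f₁ ^ 3 + C α' * f₁ * g₁ ^ 2 + C β' * g₁ ^ 3) =
        (X ^ 3 + C α * X + C β) * (derivative f₁ * g₁ - f₁ * derivative g₁) ^ 2 := by
  have hinj : Function.Injective (algebraMap (↥(algebraicClosure ℚ ℝ)) ℝ) :=
    (algebraMap (↥(algebraicClosure ℚ ℝ)) ℝ).injective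
  obtain ⟨hg0, hc0⟩ := g_ne_zero_and_c_ne_zero hW hI
  -- lift everything to `K = algebraicClosure ℚ ℝ`
  obtain ⟨F, rfl⟩ := exists_map_eq_of_coeff_isAlgebraic f hf
  obtain ⟨G, rfl⟩ := exists_map_eq_of_coeff_isAlgebraic g hg
  obtain ⟨cK, rfl⟩ : ∃ z : ↥(algebraicClosure ℚ ℝ), (z : ℝ) = c :=
    ⟨⟨c, mem_algebraicClosure_iff.2 hc⟩, rfl⟩
  obtain ⟨αK, rfl⟩ : ∃ z : ↥(algebraicClosure ℚ ℝ), (z : ℝ) = α :=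
    ⟨⟨α, mem_algebraicClosure_iff.2 hα⟩, rfl⟩
  obtain ⟨βK, rfl⟩ : ∃ z : ↥(algebraicClosure ℚ ℝ), (z : ℝ) = β :=
    ⟨⟨β, mem_algebraicClosure_iff.2 hβ⟩, rfl⟩
  obtain ⟨α'K, rfl⟩ : ∃ z : ↥(algebraicClosure ℚ ℝ), (z : ℝ) = α' :=
    ⟨⟨α', mem_algebraicClosure_iff.2 hα'⟩, rfl⟩
  obtain ⟨β'K, rfl⟩ : ∃ z : ↥(algebraicClosure ℚ ℝ), (z : ℝ) = β' :=
    ⟨⟨β', mem_algebraicClosure_iff.2 hβ'⟩, rfl⟩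
  obtain ⟨m1, m2⟩ := map_identity (algebraMap (↥(algebraicClosure ℚ ℝ)) ℝ) F G αK βK α'K β'K cK
  simp only [algebraMap_algebraicClosure_apply] at m1 m2
  -- the datum over `K`
  have hGne : G ≠ 0 := by
    rintro rfl
    exact hg0 (Polynomial.map_zero _)
  have hcKne : cK ≠ 0 := by
    rintro rfl
    exact hc0 rfl
  have hWK : derivative F * G - F * derivative G ≠ 0 := by
    intro h
    apply hW
    rw [← map_wronskian, h, Polynomial.map_zero]
  have hIK : (X ^ 3 + C αK * X + C βK) * (derivative F * G - F * derivative G) ^ 2 =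
      C (cK ^ 2) * G * (F ^ 3 + C α'K * F * G ^ 2 + C β'K * G ^ 3) := by
    apply Polynomial.map_injective _ hinj
    rw [m1, m2]
    exact hI.symm
  have hcert : HasXMapCertificate αK βK α'K β'K := ⟨F, G, cK, hGne, hcKne, hWK, hIK⟩
  -- lowest terms over `K`, mapped back to `ℝ[X]`
  obtain ⟨F₁, G₁, u, hcop, -, -, hW₁, hI₁⟩ := hcert.exists_isCoprime
  rw [xMapWronskian_def] at hW₁ hI₁
  obtain ⟨n1, n2⟩ := map_identity (algebraMap (↥(algebraicClosure ℚ ℝ)) ℝ) F₁ G₁ αK βK α'K β'K u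
  simp only [algebraMap_algebraicClosure_apply] at n1 n2
  refine ⟨F₁.map (algebraMap _ ℝ), G₁.map (algebraMap _ ℝ), (u : ℝ), coeff_map_isAlgebraic F₁,
    coeff_map_isAlgebraic G₁, algebraicClosure_isAlgebraic u,
    by simpa only [coe_mapRingHom] using hcop.map (mapRingHom (algebraMap _ ℝ)), ?_, ?_⟩
  · intro h
    apply hW₁
    apply Polynomial.map_injective _ hinj
    rw [map_wronskian, h, Polynomial.map_zero]
  · rw [← n1, ← n2, hI₁]

/-- The same with the datum bundled as in the crux `AlgebraicModuliRealPeriodCell`'s stub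
`stub_algXMapTransfer`. [cite: Washington2008, §2.9] -/
theorem exists_isCoprime_datum' {α β α' β' : ℝ} (hα : IsAlgebraic ℚ α) (hβ : IsAlgebraic ℚ β)
    (hα' : IsAlgebraic ℚ α') (hβ' : IsAlgebraic ℚ β')
    (h : ∃ (f g : ℝ[X]) (c : ℝ), (∀ n, IsAlgebraic ℚ (f.coeff n)) ∧
      (∀ n, IsAlgebraic ℚ (g.coeff n)) ∧ IsAlgebraic ℚ c ∧
      derivative f * g - f * derivative g ≠ 0 ∧
      C (c ^ 2) * g * (f ^ 3 + C α' * f * g ^ 2 + C β' * g ^ 3) =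
        (X ^ 3 + C α * X + C β) * (derivative f * g - f * derivative g) ^ 2) :
    ∃ (f g : ℝ[X]) (c : ℝ), (∀ n, IsAlgebraic ℚ (f.coeff n)) ∧
      (∀ n, IsAlgebraic ℚ (g.coeff n)) ∧ IsAlgebraic ℚ c ∧ IsCoprime f g ∧
      derivative f * g - f * derivative g ≠ 0 ∧
      C (c ^ 2) * g * (f ^ 3 + C α' * f * g ^ 2 + C β' * g ^ 3) =
        (X ^ 3 + C α * X + C β) * (derivative f * g - f * derivative g) ^ 2 := by
  obtain ⟨f, g, c, hf, hg, hc, hW, hI⟩ := h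
  exact exists_isCoprime_datum hα hβ hα' hβ' hf hg hc hW hI

/-- In a coprime datum, `f` does not vanish at a real zero of `g`. [folklore] -/
theorem eval_ne_zero_of_isCoprime {f g : ℝ[X]} (hcop : IsCoprime f g) {p : ℝ} (hG : g.eval p = 0) :
    f.eval p ≠ 0 := by
  obtain ⟨u, v, huv⟩ := hcop
  have h := congrArg (eval p) huv
  simp only [eval_add, eval_mul, eval_one, hG, mul_zero, add_zero] at h
  intro hF
  rw [hF, mul_zero] at h
  exact zero_ne_one h

/-- **Registered sub-stub `stub_transferDatum`** of stub T (`stub_algXMapTransfer`) of the line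
`Sketch`: WLOG the real-algebraic datum is in lowest terms (`IsCoprime f g`), with the forced
non-degeneracies `g ≠ 0`, `c ≠ 0` recorded. [cite: Washington2008, §2.9] -/
theorem stub_transferDatum : ∀ (α β α' β' : ℝ), IsAlgebraic ℚ α → IsAlgebraic ℚ β → IsAlgebraic ℚ α' → IsAlgebraic ℚ β' → (∃ (f g : Polynomial ℝ) (c : ℝ), (∀ n, IsAlgebraic ℚ (f.coeff n)) ∧ (∀ n, IsAlgebraic ℚ (g.coeff n)) ∧ IsAlgebraic ℚ c ∧ Polynomial.derivative f * g - f * Polynomial.derivative g ≠ 0 ∧ Polynomial.C (c ^ 2) * g * (f ^ 3 + Polynomial.C α' * f * g ^ 2 + Polynomial.C β' * g ^ 3) = (Polynomial.X ^ 3 + Polynomial.C α * Polynomial.X + Polynomial.C β) * (Polynomial.derivative f * g - f * Polynomial.derivative g) ^ 2) → ∃ (f g : Polynomial ℝ) (c : ℝ), (∀ n, IsAlgebraic ℚ (f.coeff n)) ∧ (∀ n, IsAlgebraic ℚ (g.coeff n)) ∧ IsAlgebraic ℚ c ∧ IsCoprime f g ∧ g ≠ 0 ∧ c ≠ 0 ∧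 Polynomial.derivative f * g - f * Polynomial.derivative g ≠ 0 ∧ Polynomial.C (c ^ 2) * g * (f ^ 3 + Polynomial.C α' * f * g ^ 2 + Polynomial.C β' * g ^ 3) = (Polynomial.X ^ 3 + Polynomial.C α * Polynomial.X + Polynomial.C β) * (Polynomial.derivative f * g - f * Polynomial.derivative g) ^ 2 := by
  intro α β α' β' hα hβ hα' hβ' h
  obtain ⟨f, g, c, hf, hg, hc, hcop, hW, hI⟩ := exists_isCoprime_datum' hα hβ hα' hβ' h
  have h0 := g_ne_zero_and_c_ne_zero hW hI
  exact ⟨f, g, c, hf, hg, hc, hcop, h0.1, h0.2, hW, hI⟩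

end Summit.KontsevichZagierPeriods.IsogenyCertificates.AlgRealPeriodCell.TransferDatum

end
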